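import Summits.QuantumFields.QCD.Theorems.NestedDissectionSeaRobustYangMillsStubDeploymentUKP
import Summits.QuantumFields.QCD.Theses.HeavyThresholdYMBridge
import Literature.Probability.LatticeModels.CoarseCellMixingDefectsAnnealed
import Literature.MathematicalPhysics.QuantumFieldTheory.QuasiLocalGaugePerturbationBlockLeak

/-!
# Line `local-ac-open-certificate` for the crux `RobustYangMills` (stmt-QuantumFields-13897) —
# the Wilson slice of the OPEN stub `stub_wilsonCertificate`: the certificate CONTAINS stmt-8796

Crux: `Summit.QuantumFields.QCD.Theses.HeavyThresholdYMBridge.RobustYangMills` (shared verbatim with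
`NestedDissectionSea.RobustYangMills`); checked skeleton
`Cruxes/RobustYangMills/Lines/local_ac_open_certificate.lean`; companion modules
`NestedDissectionSeaRobustYangMillsLocalAC` (§0–§1, `stub_localAC`),
`NestedDissectionSeaRobustYangMillsStubDeployment{,UKP}` (`WilsonGoodCertificateUKP`, `level_numerics`,
`final_numeric`, `level_bound`, `stub_deploymentUKP`).

**Size theorem for the open bet.** The registered stub `stub_wilsonCertificate : WilsonGoodCertificateUKP`
(a Dobrushin–Shlosman good-exterior finite-size certificate for the SU(3) Wilson kernels along every
asymptotically free coupling sequence, with Peierls-rare bad cells and the kernel-uniform Peierls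
bound) is NOT proved here. This module proves, unconditionally, that it contains the existing ledger
item stmt-QuantumFields-8796,
`Summit.QuantumFields.QCD.Theses.HeavyThresholdYMBridge.YMLatticeGapAlongAFSequences` (the SU(3)
lattice mass gap, uniformly in the volume, along EVERY a.f. Wilson sequence):

`ymLatticeGapAlongAFSequences_of_wilsonCertificate : WilsonGoodCertificateUKP → YMLatticeGapAlongAFSequences`.

**Proof** (the landed deployment `stub_deploymentUKP` run verbatim at `W ≡ 0`). At `W = 0` the
perturbed specification IS Wilson's (`wilsonSpec ρ β = spec ρ β 0`), it is block-MARKOV at the cell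
scale (`QuasiLocalGaugePerturbation.hasBlockLeak_kernel_zero`: `HasBlockLeak cell γ₀ 0 r`), so the
only mixing input needed is the PROVED block-Markov engine
`Literature.Probability.LatticeModels.annealed_influence_markov_defects` (van den Berg–Maes /
Dobrushin–Shlosman with Peierls-rare defects): `∫ |γ_Λ f − ν f| dν ≤ C e^{|Δf|} |Δg| e^{−κₑ D}` for
`[0,1]`-valued cell-local `f`. Its covariance form (`abs_covariance_le_of_annealed_influence`:
`|cov_ν(f,g)| ≤ B_g ∫ |γ_Λ f − ν f| dν`, `abs_covariance_le_integral_abs`, and the rescaling of `f` to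
`[0,1]`, `integral_abs_kernel_sub_rescale`) feeds the one-level species bound `level_bound_exp`
(`level_bound` with `e^{|Δf|}` in place of `|Δf|`; `|Δf| ≤ |supp A|` by `Finset.card_image_le`).
Given a.f. data `(a, L, β', Λ')`, the IR block scale is CHOSEN, `ℓ₀ := c₁ / Λ'` (so `c₁ ≤ Λ'ℓ₀`), the
certificate is called at the engine's rarity threshold `p := q₀` and cell scale `C := 2Λ'ℓ₀`;
eventually in `k` (`a_k ≤ min 1 ℓ₀`, `(4n+3)(2ℓ₀+1) ≤ a_k L_k`) the frames `prodFrame (2S+1) ⌈2ℓ₀/a_k⌉ μ`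
of `level_numerics` are torus frames, the certificate gives `IsGoodFS` (with `2ε₀·shellCount ≤ 1`, so
`ε₀·shellCount ≤ 3/4`) and `UniformKernelPeierls` for Wilson's kernels, DLR is toolkit (c) at `W = 0`
(`stub_localAC`, `perturbedMeasure_zero`), and `latticeConnectedCorr` is the `W = 0` connected
correlation (`connectedCorr_zero`), a covariance by translation invariance of `total 0 = 0`
(`connectedCorr_eq_covCorr`, `covCorr_eq_integral`). Output rate `Δ' = κₑ/(6ℓ₀)`.

Sources: van den Berg–Maes, Ann. Probab. 22 (1994) §2; Dobrushin–Shlosman (1985) §2; Georgii (2011)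
§8.2, Rem. 1.24; Osterwalder–Seiler, Ann. Phys. 110 (1978) §2; Jaffe–Witten (2000) §5.
-/

set_option autoImplicit false

noncomputable section

namespace Summit.QuantumFields.QCD.Cruxes.RobustYangMills.LocalAcOpenCertificate

open scoped BigOperators Topology ENNReal
open Filter MeasureTheory
open Literature.MathematicalPhysics.QuantumLattice Literature.MathematicalPhysics.AQFT
  Literature.MathematicalPhysics.QuantumFieldTheory
open Literature.Probability.LatticeModels (CoarseIdx cdist shellCount cellCount IsGoodFS HasBlockLeak
  UniformKernelPeierls IsTorusFrame isTorusFrame_axisFrame Specification IsSpecification IsGibbsMeasure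
  abs_covariance_le_integral_abs integral_abs_kernel_sub_rescale)

/-! ## The block-Markov engine in covariance form and the one-level species bound -/

section Proof

/-- **Covariance form of an annealed boundary-influence bound** (the second half of the landed
`stub_engineOfAnnealedBQL`, for ONE specification): if every `[0,1]`-valued cell-local observable `f`
of the cells `Δf` has averaged boundary influence `∫ |γ_Λ f − ν f| dν ≤ C e^{|Δf|} |Δg| e^{−κₑ D}`
(`Λ :=` the sites whose cell is not in `Δg`, `D ≤ cdist(Δf, Δg)`), then for bounded measurable
cell-local `f, g`, `|cov_ν(f,g)| ≤ 2C B_f B_g e^{|Δf|} |Δg| e^{−κₑ D}`: the DLR covariance bound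
`|cov_ν(f,g)| ≤ B_g ∫ |γ_Λ f − ν f| dν` (`abs_covariance_le_integral_abs`) and the affine rescaling of
`f` to `[0,1]` (`integral_abs_kernel_sub_rescale`, factor `2B_f`; `B_f = 0` forces `f = 0`). -/
theorem abs_covariance_le_of_annealed_influence {μc : Fin 4 → ℕ} {V S : Type} [Fintype V]
    [MeasurableSpace S] {cell : V → CoarseIdx μc} {γ : Specification V S} {ν : Measure (V → S)}
    (hγ : IsSpecification γ) (hν : IsGibbsMeasure γ ν) {C κₑ : ℝ} (hC : 0 ≤ C)
    (hcore : ∀ (f : (V → S) → ℝ) (Δf Δg : Finset (CoarseIdx μc)) (D : ℕ),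
      Measurable f → (∀ σ, 0 ≤ f σ ∧ f σ ≤ 1) → DependsOn f {v | cell v ∈ Δf} →
      (∀ x ∈ Δf, ∀ y ∈ Δg, D ≤ cdist x y) →
        ∫ ζ, |∫ σ, f σ ∂(γ (Finset.univ.filter fun v => cell v ∉ Δg) ζ) - ∫ σ, f σ ∂ν| ∂ν ≤
          C * Real.exp (Δf.card) * Δg.card * Real.exp (-(κₑ * D)))
    (f g : (V → S) → ℝ) (Δf Δg : Finset (CoarseIdx μc)) (Bf Bg : ℝ) (D : ℕ)
    (hf : Measurable f) (hg : Measurable g) (hfB : ∀ σ, |f σ| ≤ Bf) (hgB : ∀ σ, |g σ| ≤ Bg)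
    (hfdep : DependsOn f {v | cell v ∈ Δf}) (hgdep : DependsOn g {v | cell v ∈ Δg})
    (hD : ∀ x ∈ Δf, ∀ y ∈ Δg, D ≤ cdist x y) :
    |∫ σ, f σ * g σ ∂ν - (∫ σ, f σ ∂ν) * ∫ σ, g σ ∂ν| ≤
      2 * C * Bf * Bg * Real.exp (Δf.card) * Δg.card * Real.exp (-(κₑ * D)) := by
  haveI := hν.isProbabilityMeasure
  set Λ : Finset V := Finset.univ.filter fun v => cell v ∉ Δg with hΛ
  have hgdep' : DependsOn g ((↑Λ : Set V)ᶜ) := by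
    refine fun σ τ hστ => hgdep fun v hv => hστ v ?_
    intro hvΛ
    exact (Finset.mem_filter.1 (Finset.mem_coe.1 hvΛ)).2 hv
  obtain ⟨σ₀⟩ : Nonempty (V → S) := by
    obtain ⟨σ, -⟩ := nonempty_of_measure_ne_zero (μ := ν) (s := Set.univ) (by simp)
    exact ⟨σ⟩
  have hBf : 0 ≤ Bf := (abs_nonneg _).trans (hfB σ₀)
  have hBg : 0 ≤ Bg := (abs_nonneg _).trans (hgB σ₀)
  have hcov := abs_covariance_le_integral_abs hγ hν Λ hf hg hfB hgB hgdep'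
  have hRHS : 0 ≤ 2 * C * Bf * Bg * Real.exp (Δf.card) * Δg.card * Real.exp (-(κₑ * D)) := by
    positivity
  rcases hBf.eq_or_lt with hBf0 | hBfpos
  · have hf0 : ∀ σ, f σ = 0 := fun σ => abs_nonpos_iff.1 (hBf0 ▸ hfB σ)
    have : ∫ σ, f σ * g σ ∂ν - (∫ σ, f σ ∂ν) * ∫ σ, g σ ∂ν = 0 := by simp [hf0]
    rw [this, abs_zero]
    exact hRHS
  · set f' : (V → S) → ℝ := fun σ => (f σ / Bf + 1) / 2 with hf'
    have hf'm : Measurable f' := ((hf.div_const Bf).add_const 1).div_const 2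
    have hf'01 : ∀ σ, 0 ≤ f' σ ∧ f' σ ≤ 1 := fun σ => by
      have h := hfB σ
      rw [abs_le] at h
      have hlo : -1 ≤ f σ / Bf := by rw [le_div_iff₀ hBfpos]; linarith [h.1]
      have hhi : f σ / Bf ≤ 1 := by rw [div_le_iff₀ hBfpos]; linarith [h.2]
      simp only [hf']
      constructor <;> linarith
    have hf'dep : DependsOn f' {v | cell v ∈ Δf} := fun σ τ hστ => by
      simp only [hf', hfdep hστ]
    have hcore' := hcore f' Δf Δg D hf'm hf'01 hf'dep hD
    have hresc := integral_abs_kernel_sub_rescale hγ (ν := ν) Λ hf hfB hBfpos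
    calc |∫ σ, f σ * g σ ∂ν - (∫ σ, f σ ∂ν) * ∫ σ, g σ ∂ν|
        ≤ Bg * ∫ ζ, |∫ σ, f σ ∂(γ Λ ζ) - ∫ σ, f σ ∂ν| ∂ν := hcov
      _ = Bg * (2 * Bf * ∫ ζ, |∫ σ, f' σ ∂(γ Λ ζ) - ∫ σ, f' σ ∂ν| ∂ν) := by rw [hresc]
      _ ≤ Bg * (2 * Bf * (C * Real.exp (Δf.card) * Δg.card * Real.exp (-(κₑ * D)))) := by gcongr
      _ = 2 * C * Bf * Bg * Real.exp (Δf.card) * Δg.card * Real.exp (-(κₑ * D)) := by ring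

/-- **One level of the deployment, block-Markov shape** (`level_bound` with the engine factor
`e^{|Δf|}` in place of `|Δf|`): a covariance bound `C₀ B_f B_g e^{|Δf|} |Δg| e^{-κₑ D}` for cell-local
observables under `ν` on the torus `2S+1` (frame scale `b'`, `μ + 1` cells per axis) gives, for two
species read through the periodic lift and the time shift `t ≤ S`, the bound
`C₀ C_A C_B e^{|supp A|} |supp B| e^{κₑ(δ₀+2)} e^{-(κₑ/6ℓ₀) a t}` (`|Δf| ≤ |supp A|` by
`Finset.card_image_le`, cell distance by `le_cdist_cellOf_torusEdge_timeShift`, rates by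
`final_numeric`). -/
theorem level_bound_exp {S b' μ : ℕ} {κₑ C₀ a ℓ₀ : ℝ} (hb' : 0 < b') (h2 : 2 * S + 1 < μ * b' + 2 * b')
    (hκₑ : 0 < κₑ) (hC₀ : 0 ≤ C₀) (hℓ₀ : 0 < ℓ₀) (h6 : (2 * b' : ℝ) * a ≤ 6 * ℓ₀)
    (ν : Measure (GaugeConfig 4 (2 * S + 1) SU3))
    (hcov : ∀ (f g : GaugeConfig 4 (2 * S + 1) SU3 → ℝ)
      (Δf Δg : Finset (CoarseIdx (fun _ : Fin 4 => μ))) (Bf Bg : ℝ) (D : ℕ),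
      Measurable f → Measurable g → (∀ σ, |f σ| ≤ Bf) → (∀ σ, |g σ| ≤ Bg) →
      DependsOn f {v | cellOf (prodFrame (2 * S + 1) b' μ) v ∈ Δf} →
      DependsOn g {v | cellOf (prodFrame (2 * S + 1) b' μ) v ∈ Δg} →
      (∀ x ∈ Δf, ∀ y ∈ Δg, D ≤ cdist x y) →
        |∫ σ, f σ * g σ ∂ν - (∫ σ, f σ ∂ν) * ∫ σ, g σ ∂ν| ≤
          C₀ * Bf * Bg * Real.exp (Δf.card) * Δg.card * Real.exp (-(κₑ * D)))
    (A B : YMSpecies SU3) {Ca Cb : ℝ} (hCa : ∀ U, |A.F U| ≤ Ca) (hCb : ∀ U, |B.F U| ≤ Cb) {t : ℕ}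
    (ht : t ≤ S) :
    |∫ U, A.F (torusLift (2 * S + 1) U) *
          B.F (configShift (-Pi.single 0 (t : ℤ)) (torusLift (2 * S + 1) U)) ∂ν -
        (∫ U, A.F (torusLift (2 * S + 1) U) ∂ν) *
          ∫ U, B.F (configShift (-Pi.single 0 (t : ℤ)) (torusLift (2 * S + 1) U)) ∂ν| ≤
      C₀ * Ca * Cb * Real.exp (A.supp.card) * B.supp.card *
        Real.exp (κₑ * (((A.supp.sup fun e => (e.1 0).natAbs) +
          (B.supp.sup fun e => (e.1 0).natAbs) + 2 : ℕ) : ℝ)) *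
        Real.exp (-(κₑ / (6 * ℓ₀) * (a * t))) := by
  have hf : Measurable fun U : GaugeConfig 4 (2 * S + 1) SU3 => A.F (torusLift (2 * S + 1) U) :=
    A.measurable.comp (measurable_torusLift _)
  have hg : Measurable fun U : GaugeConfig 4 (2 * S + 1) SU3 =>
      B.F (configShift (-Pi.single (0 : Fin 4) (t : ℤ)) (torusLift (2 * S + 1) U)) :=
    B.measurable.comp ((configShift _).measurable.comp (measurable_torusLift _))
  have hmain := hcov _ _ _ _ Ca Cb _ hf hg (fun U => hCa _) (fun U => hCb _)
    (dependsOn_comp_torusLift A.isCylinder _)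
    (dependsOn_comp_configShift_torusLift B.isCylinder _ _)
    (le_cdist_cellOf_torusEdge_timeShift hb' h2 A.supp B.supp ht)
  refine hmain.trans ?_
  have hCa0 : 0 ≤ Ca := (abs_nonneg _).trans (hCa fun _ => 1)
  have hCb0 : 0 ≤ Cb := (abs_nonneg _).trans (hCb fun _ => 1)
  have hΔf : Real.exp ((A.supp.image fun e => cellOf (prodFrame (2 * S + 1) b' μ)
      (torusEdge (2 * S + 1) e)).card : ℝ) ≤ Real.exp (A.supp.card : ℝ) :=
    Real.exp_le_exp.2 (by exact_mod_cast Finset.card_image_le)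
  have hΔg : ((B.supp.image fun e => cellOf (prodFrame (2 * S + 1) b' μ)
      (torusEdge (2 * S + 1) (e.1 - -Pi.single (0 : Fin 4) (t : ℤ), e.2))).card : ℝ) ≤
      B.supp.card := by
    exact_mod_cast Finset.card_image_le
  have hnum := final_numeric (t := t)
    (δ₀ := (A.supp.sup fun e => (e.1 0).natAbs) + (B.supp.sup fun e => (e.1 0).natAbs))
    (a := a) hκₑ hℓ₀ hb' h6
  have hK : 0 ≤ C₀ * Ca * Cb := by positivity
  generalize (A.supp.image fun e => cellOf (prodFrame (2 * S + 1) b' μ)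
      (torusEdge (2 * S + 1) e)).card = cf at *
  generalize (B.supp.image fun e => cellOf (prodFrame (2 * S + 1) b' μ)
      (torusEdge (2 * S + 1) (e.1 - -Pi.single (0 : Fin 4) (t : ℤ), e.2))).card = cg at *
  generalize t / (2 * b') -
    ((A.supp.sup fun e => (e.1 0).natAbs) + (B.supp.sup fun e => (e.1 0).natAbs) + 1) = D at *
  have hprod := mul_le_mul hΔf hΔg (Nat.cast_nonneg _) (Real.exp_pos _).le
  have hE : 0 ≤ Real.exp (-(κₑ * D)) := (Real.exp_pos _).le
  calc C₀ * Ca * Cb * Real.exp (cf : ℝ) * cg * Real.exp (-(κₑ * D))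
      = (C₀ * Ca * Cb) * (Real.exp (cf : ℝ) * cg) * Real.exp (-(κₑ * D)) := by ring
    _ ≤ (C₀ * Ca * Cb) * (Real.exp (A.supp.card : ℝ) * B.supp.card) * Real.exp (-(κₑ * D)) :=
        mul_le_mul_of_nonneg_right (mul_le_mul_of_nonneg_left hprod hK) hE
    _ ≤ (C₀ * Ca * Cb) * (Real.exp (A.supp.card : ℝ) * B.supp.card) *
        (Real.exp (κₑ * (((A.supp.sup fun e => (e.1 0).natAbs) +
          (B.supp.sup fun e => (e.1 0).natAbs) + 2 : ℕ) : ℝ)) *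
          Real.exp (-(κₑ / (6 * ℓ₀) * (a * t)))) :=
        mul_le_mul_of_nonneg_left hnum (by positivity)
    _ = _ := by ring

end Proof

/-! ## The size theorem: the certificate contains stmt-QuantumFields-8796 -/

/-- **The Wilson slice of the open certificate (size theorem for `stub_wilsonCertificate`)**: the
strengthened SU(3) Wilson certificate `WilsonGoodCertificateUKP` implies the ledger item
stmt-QuantumFields-8796 `YMLatticeGapAlongAFSequences` — the SU(3) lattice mass gap in the units set
by `a_k`, uniformly in the volume, along EVERY asymptotically free Wilson sequence. Proof: the landed
deployment at `W ≡ 0` (Wilson's kernels ARE the reference specification and are block-Markov,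
`hasBlockLeak_kernel_zero`), through the PROVED block-Markov engine
`annealed_influence_markov_defects` in covariance form (`abs_covariance_le_of_annealed_influence`,
`level_bound_exp`); the IR block scale is chosen as `ℓ₀ := c₁/Λ'`, the certificate is called at the
engine's rarity threshold `q₀` and cell scale `2Λ'ℓ₀`; DLR is toolkit (c) of `stub_localAC` at `W = 0`;
`latticeConnectedCorr` is the `W = 0` covariance (`connectedCorr_zero`, `connectedCorr_eq_covCorr`).
Rate `Δ' = κₑ/(6ℓ₀)`. Hence the OPEN stub contains the uniform SU(3) lattice gap (YM-hard). -/
theorem ymLatticeGapAlongAFSequences_of_wilsonCertificate :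
    WilsonGoodCertificateUKP → Summit.QuantumFields.QCD.Theses.HeavyThresholdYMBridge.YMLatticeGapAlongAFSequences := by
  rintro ⟨n, -, hcert⟩ a L ha ha₀ haL β' ⟨Λ', hΛ', hβ⟩
  -- the block-Markov engine at window `n`, the certificate at its rarity threshold, DLR (toolkit (c))
  obtain ⟨q₀, κₑ, C, hq₀, hκₑ, hC, hEng⟩ :=
    Literature.Probability.LatticeModels.annealed_influence_markov_defects.{0, 0} 4 n
  obtain ⟨ε₀, c₁, hε₀, hshell, hc₁, hcert⟩ := hcert q₀ hq₀
  obtain ⟨-, -, hDLR⟩ := stub_localAC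
  have hshell' : ε₀ * (shellCount 4 n : ℝ) ≤ 3 / 4 := by linarith
  -- the IR block scale `ℓ₀ := c₁ / Λ'`
  obtain ⟨ℓ₀, hℓ₀def⟩ : ∃ ℓ₀ : ℝ, ℓ₀ = c₁ / Λ' := ⟨_, rfl⟩
  have hℓ₀pos : 0 < ℓ₀ := by rw [hℓ₀def]; exact div_pos hc₁ hΛ'
  have hℓ₀ : c₁ ≤ Λ' * ℓ₀ := by rw [hℓ₀def, mul_div_cancel₀ _ hΛ'.ne']
  refine ⟨κₑ / (6 * ℓ₀), by positivity, fun A B => ?_⟩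
  obtain ⟨Ca, hCa⟩ := A.bounded
  obtain ⟨Cb, hCb⟩ := B.bounded
  refine ⟨2 * C * Ca * Cb * Real.exp (A.supp.card) * B.supp.card *
    Real.exp (κₑ * (((A.supp.sup fun e => (e.1 0).natAbs) +
      (B.supp.sup fun e => (e.1 0).natAbs) + 2 : ℕ) : ℝ)), ?_⟩
  have hev1 : ∀ᶠ k in atTop, a k ≤ min 1 ℓ₀ := ha₀.eventually_le_const (lt_min one_pos hℓ₀pos)
  have hev2 : ∀ᶠ k in atTop, (4 * (n : ℝ) + 3) * (2 * ℓ₀ + 1) ≤ a k * L k :=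
    haL.eventually_ge_atTop _
  have hev3 := hcert a ha ha₀ β' Λ' hΛ' hβ (2 * (Λ' * ℓ₀)) (by linarith)
  filter_upwards [hev1, hev2, hev3] with k hk1 hk2 hk3
  intro S hS t ht
  obtain ⟨hb, hb', hbb, h2b, h1, h2, hμ, h6⟩ := level_numerics (n := n) (ha k)
    (hk1.trans (min_le_left _ _)) (hk1.trans (min_le_right _ _)) hk2 hS
  set b' := ⌈2 * ℓ₀ / a k⌉₊ with hb'def
  set μ := (2 * S + 1) / b' - 1 with hμdef
  have hCeq : ⌈2 * (Λ' * ℓ₀) / (Λ' * a k)⌉₊ = b' := by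
    rw [hb'def]; congr 1; field_simp
  obtain ⟨good, hFS, -, hUKP⟩ := hk3 S (fun _ => μ) (prodFrame (2 * S + 1) b' μ) (fun _ => hμ)
    (fun _ => by rw [hCeq]; exact isTorusFrame_axisFrame hb' h1 h2)
  -- DLR for Wilson (toolkit (c) at `W = 0`); Wilson's kernels are block-Markov through cells
  have hρ : Continuous ρ₃ := continuous_fundamentalRep _
  obtain ⟨hsp0, hg0⟩ := hDLR SU3 3 ρ₃ hρ (2 * S + 1) 1 (β' k) 0
  rw [QuasiLocalGaugePerturbation.perturbedMeasure_zero] at hg0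
  have hK : ∀ A : Finset (Edge 4 (2 * S + 1)),
      ((A.image fun e => blockCorner ⌊ℓ₀ / a k⌋₊ e.1).card : ℝ) ≤
        10 ^ 4 * cellCount (cellOf (prodFrame (2 * S + 1) b' μ)) A := fun A => by
    exact_mod_cast card_image_blockCorner_le_mul_cellCount (μ := μ) hb hb' hbb h2 A
  have hcon := cdist_cellOf_le_of_blockCorner_near (d := 4) (μ := μ) hb hb' h2b h1
  have hBL : HasBlockLeak (cellOf (prodFrame (2 * S + 1) b' μ)) (wilsonSpec ρ₃ (β' k)) 0 1 :=
    QuasiLocalGaugePerturbation.hasBlockLeak_kernel_zero ρ₃ hρ hb _ hK hcon (β' k) zero_le_one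
  -- the block-Markov engine at this level, in covariance form, for Wilson's measure
  have hcov := abs_covariance_le_of_annealed_influence hsp0 hg0 hC
    (hEng (cellOf (prodFrame (2 * S + 1) b' μ)) (wilsonSpec ρ₃ (β' k)) good
      (wilsonMeasure ρ₃ (β' k)) ε₀ q₀ 1 (fun _ => hμ) hsp0 hg0 hε₀ hshell' hFS hBL hq₀.le le_rfl
      hUKP)
  -- `latticeConnectedCorr` is the `W = 0` connected correlation, a covariance under Wilson's measure
  rw [← QuasiLocalGaugePerturbation.connectedCorr_zero ρ₃ (β' k) (2 * S + 1) (b := 1) A.F B.F t,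
    QuasiLocalGaugePerturbation.connectedCorr_eq_covCorr
      (0 : QuasiLocalGaugePerturbation 4 (2 * S + 1) SU3 1) ρ₃ (β' k) (fun v U => by simp),
    QuasiLocalGaugePerturbation.covCorr_eq_integral,
    QuasiLocalGaugePerturbation.perturbedMeasure_zero]
  exact level_bound_exp hb' h2 hκₑ (by positivity) hℓ₀pos h6 _ hcov A B hCa hCb ht

end Summit.QuantumFields.QCD.Cruxes.RobustYangMills.LocalAcOpenCertificate

end
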